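import Summits.CriticalPhenomena.CardyFormulaZ2.Theorems.CardyComplexConeCoherentMorera
import Summits.CriticalPhenomena.CardyFormulaZ2.Theses.CardySusyWard

/-!
# Census companion: the crux `CardySusyWard.WeakHolomorphy` (stmt-11292) follows from the sibling
route's rank-2 crux `CardyComplexCone.EdgeCoherence` (stmt-11385) ALONE, by the landed stubs of the
proved sibling crux `CoherentMorera` (stmt-11388; `EdgePrecompact` enters only its second clause).
Kernel-checked here for the STRATEGY-CENSUS (§Decomposition D3); not a line.
-/

noncomputable section

namespace Summit.CriticalPhenomena.CardyFormulaZ2.Cruxes.WeakHolomorphy.Census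

open scoped BigOperators Topology
open Filter Set MeasureTheory
open _root_.Literature.Probability.LatticeModels
open _root_.Literature.Probability.RandomPlanarGeometry (DobrushinDomain)
open Summit.CriticalPhenomena.CardyFormulaZ2.Cruxes.CoherentMorera.FinitaryGreenPairing
open Summit.CriticalPhenomena.CardyFormulaZ2.Theses.CardyComplexCone (EdgeCoherence)
open Summit.CriticalPhenomena.CardyFormulaZ2.Theses.CardySusyWard (WeakHolomorphy)

/-- **Cross-route implication.** `EdgeCoherence → WeakHolomorphy` (the three Hausdorff hypotheses of
the family form are simply not used). [folklore] -/
theorem weakHolomorphy_of_edgeCoherence (hC : EdgeCoherence) : WeakHolomorphy := by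
  intro D Λ hΩ hδ _hA _hB _hab hadm φ hφ hsupp hsub
  have hG : Guards D Λ := ⟨hΩ, hδ, hadm⟩
  have hT : TestFn D φ := ⟨hφ, hsupp, hsub⟩
  obtain ⟨u, hu0, hu⟩ := hC
  have h0 : ScaledNull (P0 Λ φ) :=
    scaledNull_of_sub_of_or (spinShift_of stub_pairingBound stub_kirchhoff D Λ hG φ hT)
      (stub_modeSelection u hu0 hu (stub_coherenceShift u hu) D Λ hG φ hT)
  exact (stub_siteRegrouping D Λ hG (stub_traceIdentity D Λ hG) φ hT).2 h0

end Summit.CriticalPhenomena.CardyFormulaZ2.Cruxes.WeakHolomorphy.Census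

end
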